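import Summits.CriticalPhenomena.Ising3DConformalLimit.Theses.CanonicalBranchRefutation

/-!
# Lattice bond-mirror reflection positivity passes to every pointwise scaling limit
# (stub `stub_rpAlong_of_latticeBondRP` of line `registered`/birth for the crux
# `CanonicalBranchRefutation.IsingLimitHeritage`, item stmt-CriticalPhenomena-15523)

Statement.  Fix an axis `τ : Fin 3`, a lattice family `G` on `ℤ³`, a real renormalisation `ρ`
and a pointwise scaling limit `S` of `(G, ρ)` (`HasPointwiseScalingLimit G ρ S`).  Suppose `G` is
reflection positive through the BOND plane `{k_τ = -1/2}` in Gram form on spin monomials: for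
finitely many lattice configurations `z^a` in the closed half-lattice `{k_τ ≥ 0}` and real `c_a`,
`0 ≤ Σ_{a,b} c_a c_b G(θ♭_τ z^a ++ z^b)`, `θ♭_τ k = (k with k_τ ↦ -1 - k_τ)`.  Then `S` is
reflection positive along `τ` in the pointwise Osterwalder–Schrader sense
`IsReflectionPositiveAlong τ S` (Glimm–Jaffe 1987, §6.1 (OS3), matrix form (6.1.8)–(6.1.9) on
half-space point configurations).

Proof (no continuity of `S` is used, and no sign of `ρ`).
* Floor bookkeeping: for `t ∉ ℤ`, `⌊-t⌋ = -1 - ⌊t⌋`; hence at a mesh `δ > 0` with `p_τ/δ ∉ ℤ`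
  the lattice approximation is EXACTLY bond-mirror equivariant,
  `[θ_τ p / δ] = θ♭_τ [p / δ]` (`latticeApprox_axisReflection`), and `p_τ > 0 ⇒ [p/δ]_τ ≥ 0`.
* So at every such "generic" mesh the OS Gram sum
  `Σ_{i,j} c_i c_j ρ(δ)^{nᵢ+nⱼ} G([θ_τ aᵢ/δ] ++ [aⱼ/δ])` of the rescaled correlators IS a lattice
  Gram sum of the hypothesis, with coefficients `c_i ρ(δ)^{nᵢ}`, hence `≥ 0`.
* The non-generic meshes `{(aᵢ)_l,τ / m : m ∈ ℤ}` of the finitely many points form a countable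
  set, whose complement is dense in `ℝ` (`Set.Countable.dense_compl`); so generic meshes are
  frequent in `𝓝[>] 0`.
* The Gram sums converge to `Σ_{i,j} c_i c_j S(θ_τ aᵢ, aⱼ)` along `𝓝[>] 0` (pointwise convergence
  on the non-coincident configuration `θ_τ aᵢ ++ aⱼ`, `osPointKernel_arg_injective`), and a limit
  of a function frequently `≥ 0` is `≥ 0` (`IsClosed.mem_of_frequently_of_tendsto`).

References: J. Glimm, A. Jaffe, *Quantum Physics* (2nd ed., 1987), §6.1 (OS3);
J. Fröhlich, R. Israel, E. H. Lieb, B. Simon, Comm. Math. Phys. 62 (1978) 1–34, §2 (reflection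
positivity through bonds). No definitions are introduced.
-/

noncomputable section

namespace Summit.CriticalPhenomena.Ising3DConformalLimit.Cruxes.IsingLimitHeritage.Birth

open Literature.Probability.LatticeModels Literature.MathematicalPhysics.QuantumFieldTheory
open Filter Set
open scoped Topology

variable {d : ℕ}

/-- Floor of the negative of a non-integer: `⌊-t⌋ = -1 - ⌊t⌋` when `fract t ≠ 0`
(the bond-mirror equivariance of the integer part). -/
theorem floor_neg_eq_of_fract_ne_zero {t : ℝ} (ht : Int.fract t ≠ 0) : ⌊-t⌋ = -1 - ⌊t⌋ := by
  rw [Int.floor_neg]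
  have h1 : (⌈t⌉ : ℝ) = t + 1 - Int.fract t := Int.ceil_eq_add_one_sub_fract ht
  have h2 : t - Int.fract t = ⌊t⌋ := Int.self_sub_fract t
  have h3 : (⌈t⌉ : ℝ) = ⌊t⌋ + 1 := by linarith
  have h4 : ⌈t⌉ = ⌊t⌋ + 1 := by exact_mod_cast h3
  omega

/-- **The lattice approximation is bond-mirror equivariant on generic meshes**: if `p_τ/δ ∉ ℤ`
then `[θ_τ p/δ] = θ♭_τ [p/δ]`, i.e. the integer part of the reflected point is the image of the
integer part of `p` under `k ↦ (k with k_τ ↦ -1 - k_τ)`. -/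
theorem latticeApprox_axisReflection {δ : ℝ} (τ : Fin d) (p : EuclideanSpace ℝ (Fin d))
    (hp : Int.fract (p τ / δ) ≠ 0) :
    latticeApprox δ (axisReflection τ p) =
      Function.update (latticeApprox δ p) τ (-1 - latticeApprox δ p τ) := by
  funext j
  by_cases hj : j = τ
  · subst hj
    rw [latticeApprox_apply, axisReflection_apply, if_pos rfl, Function.update_self,
      latticeApprox_apply, neg_div, floor_neg_eq_of_fract_ne_zero hp]
  · rw [latticeApprox_apply, axisReflection_apply, if_neg hj, Function.update_of_ne hj,
      latticeApprox_apply]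

/-- **Lattice bond-mirror reflection positivity passes to every pointwise scaling limit**
(any dimension `d`, any real renormalisation `ρ`, no continuity of the limit): if the lattice
family `G` has positive semidefinite Gram form through the bond mirror `θ♭_τ` on spin monomials
supported in `{k_τ ≥ 0}`, then every pointwise scaling limit `S` of `(G, ρ)` is reflection
positive along `τ` in the pointwise OS sense. [cite: GlimmJaffe1987, §6.1 (OS3)] -/
theorem isReflectionPositiveAlong_of_latticeBondRP (τ : Fin d) (G : LatticeCorrFamily d)
    (ρ : ℝ → ℝ) (S : CorrFamily d)
    (hG : ∀ (m : ℕ) (k : Fin m → ℕ) (z : (a : Fin m) → Fin (k a) → Site d) (c : Fin m → ℝ),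
        (∀ a i, 0 ≤ z a i τ) →
        0 ≤ ∑ a, ∑ b, c a * c b *
          G (k a + k b) (Fin.append (fun i => Function.update (z a i) τ (-1 - z a i τ)) (z b)))
    (hlim : HasPointwiseScalingLimit G ρ S) : IsReflectionPositiveAlong τ S := by
  classical
  intro k a c
  -- (1) the OS Gram sums of the rescaled correlators converge to the OS Gram sum of `S`
  have hT : Tendsto (fun δ : ℝ => ∑ i, ∑ j, c i * c j *
      rescaledCorrelator G ρ ((a i).n + (a j).n) δ
        (Fin.append (fun l => axisReflection τ ((a i).pts l)) (a j).pts))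
      (𝓝[>] (0 : ℝ)) (𝓝 (∑ i, ∑ j, c i * c j * osPointKernel S (a i) (a j))) := by
    refine tendsto_finsetSum _ fun i _ => tendsto_finsetSum _ fun j _ => ?_
    exact ((hlim ((a i).n + (a j).n)).tendsto_at (osPointKernel_arg_injective (a i) (a j))).const_mul _
  -- (2) the exceptional (non-generic) meshes: `δ = p_τ / m`
  set B : Set ℝ := ⋃ i : Fin k, ⋃ l : Fin (a i).n, Set.range fun m : ℤ => (a i).pts l τ / (m : ℝ)
    with hB
  have hBc : B.Countable :=
    countable_iUnion fun i => countable_iUnion fun l => countable_range _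
  have hgood : ∀ δ : ℝ, 0 < δ → δ ∉ B → ∀ (i : Fin k) (l : Fin (a i).n),
      Int.fract ((a i).pts l τ / δ) ≠ 0 := by
    intro δ hδ hδB i l h0
    apply hδB
    have hp0 : 0 < (a i).pts l τ := (a i).pos l
    have h1 : (a i).pts l τ / δ = ⌊(a i).pts l τ / δ⌋ := by
      have h := Int.self_sub_floor ((a i).pts l τ / δ)
      rw [h0] at h
      exact sub_eq_zero.1 h
    refine mem_iUnion.2 ⟨i, mem_iUnion.2 ⟨l, ⌊(a i).pts l τ / δ⌋, ?_⟩⟩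
    show (a i).pts l τ / ((⌊(a i).pts l τ / δ⌋ : ℤ) : ℝ) = δ
    rw [← h1, div_div_eq_mul_div, mul_div_cancel_left₀ _ hp0.ne']
  -- (3) generic meshes are frequent in `𝓝[>] 0`
  have hfreq : ∃ᶠ δ in 𝓝[>] (0 : ℝ), δ ∉ B := by
    rw [Filter.frequently_iff]
    intro U hU
    obtain ⟨u, hu, hsub⟩ := mem_nhdsGT_iff_exists_Ioo_subset.1 hU
    obtain ⟨x, hxB, hxI⟩ :=
      (hBc.dense_compl ℝ).exists_mem_open isOpen_Ioo (nonempty_Ioo.2 (mem_Ioi.1 hu))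
    exact ⟨x, hsub hxI, hxB⟩
  -- (4) at a generic mesh the OS Gram sum is a lattice bond-mirror Gram sum, hence `≥ 0`
  have hfreq' : ∃ᶠ δ in 𝓝[>] (0 : ℝ), 0 ≤ ∑ i, ∑ j, c i * c j *
      rescaledCorrelator G ρ ((a i).n + (a j).n) δ
        (Fin.append (fun l => axisReflection τ ((a i).pts l)) (a j).pts) := by
    refine (hfreq.and_eventually eventually_mem_nhdsWithin).mono fun δ hδ => ?_
    obtain ⟨hδB, hδpos⟩ := hδ
    have hδ0 : (0 : ℝ) < δ := hδpos
    have hz0 : ∀ (i : Fin k) (l : Fin (a i).n), 0 ≤ latticeApprox δ ((a i).pts l) τ :=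
      fun i l => by
        rw [latticeApprox_apply]
        exact Int.floor_nonneg.2 (div_nonneg ((a i).pos l).le hδ0.le)
    have key := hG k (fun i => (a i).n) (fun i l => latticeApprox δ ((a i).pts l))
      (fun i => c i * ρ δ ^ (a i).n) hz0
    have hFδ : (∑ i, ∑ j, c i * c j *
        rescaledCorrelator G ρ ((a i).n + (a j).n) δ
          (Fin.append (fun l => axisReflection τ ((a i).pts l)) (a j).pts)) =
        ∑ i, ∑ j, (c i * ρ δ ^ (a i).n) * (c j * ρ δ ^ (a j).n) *
          G ((a i).n + (a j).n)
            (Fin.append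
              (fun l => Function.update (latticeApprox δ ((a i).pts l)) τ
                (-1 - latticeApprox δ ((a i).pts l) τ))
              (fun l => latticeApprox δ ((a j).pts l))) := by
      refine Finset.sum_congr rfl fun i _ => Finset.sum_congr rfl fun j _ => ?_
      rw [rescaledCorrelator_apply]
      have happ : (fun l => latticeApprox δ
          (Fin.append (fun l => axisReflection τ ((a i).pts l)) (a j).pts l)) =
          Fin.append
            (fun l => Function.update (latticeApprox δ ((a i).pts l)) τ
              (-1 - latticeApprox δ ((a i).pts l) τ))
            (fun l => latticeApprox δ ((a j).pts l)) := by
        funext l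
        refine Fin.addCases (fun l' => ?_) (fun l' => ?_) l
        · simp only [Fin.append_left]
          exact latticeApprox_axisReflection τ _ (hgood δ hδ0 hδB i l')
        · simp only [Fin.append_right]
      rw [happ, pow_add]
      ring
    rw [hFδ]
    exact key
  -- (5) a limit of a function frequently `≥ 0` is `≥ 0`
  exact isClosed_Ici.mem_of_frequently_of_tendsto hfreq' hT

/-- **stub_rpAlong_of_latticeBondRP** (bond-mirror lattice RP passes to EVERY pointwise scaling
limit, no continuity). For a lattice family `G` on `ℤ³` whose Gram form through the bond mirror
`θ♭_τ` is positive semidefinite on monomials supported in `{k_τ ≥ 0}`, any real `ρ`, and any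
pointwise scaling limit `S` of `(G, ρ)`: `S` is reflection positive along `τ` in the pointwise OS
sense (floor equivariance `[θ_τ p/δ] = θ♭_τ[p/δ]` on the generic meshes `p_τ/δ ∉ ℤ`, which are
frequent in `𝓝[>] 0`). Registered stub of line `registered` (birth skeleton) for the crux
`IsingLimitHeritage` (stmt-CriticalPhenomena-15523). [cite: GlimmJaffe1987, §6.1 (OS3)] -/
theorem stub_rpAlong_of_latticeBondRP :
    ∀ (τ : Fin 3) (G : LatticeCorrFamily 3) (ρ : ℝ → ℝ) (S : CorrFamily 3),
      (∀ (m : ℕ) (k : Fin m → ℕ) (z : (a : Fin m) → Fin (k a) → Site 3) (c : Fin m → ℝ),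
        (∀ a i, 0 ≤ z a i τ) →
        0 ≤ ∑ a, ∑ b, c a * c b *
          G (k a + k b) (Fin.append (fun i => Function.update (z a i) τ (-1 - z a i τ)) (z b))) →
      HasPointwiseScalingLimit G ρ S → IsReflectionPositiveAlong τ S :=
  fun τ G ρ S hG hlim => isReflectionPositiveAlong_of_latticeBondRP τ G ρ S hG hlim

end Summit.CriticalPhenomena.Ising3DConformalLimit.Cruxes.IsingLimitHeritage.Birth

end
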